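import Mathlib
import Summits.Ventures.PercRepro.PuncturedLYMFibrationOneArith

/-!
# PercRepro — THE FIBRATION OVER ONE MEMBER: THE LAYER INEQUALITIES FROM `m·ρ ≥ 1`
(p10, gen 37)

The second half of the arithmetic of PuncturedLYMFibrationOneArith: the member columns `N = C(n', ℓ+1−m)`, the
column-Hall slacks `G a` of «the member columns and the free columns above layer `a`», the closed forms of the layer
sums by Vandermonde (`sum_R`, `sum_U`), THE BINOMIAL INEQUALITY (★) `R 0 · F ≤ (U 0 + U 1) · (P − m·N)` (`star`), and
THE THEOREM `layer_ineq`: for `2 ≤ m ≤ ℓ`, `ℓ + 1 ≤ n'`, `θ ≥ 0`, `m·ρ ≥ 1` and the totals, `0 ≤ Hs a` for every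
`a ≤ m` and `Hs a ≤ θ·U a` for `1 ≤ a < m` — the two families of constraints of the fibration over the member with
Boolean fibres.  The first family is the partial-sum lemma applied to the layer excesses (`≥ 0` then `≤ 0`), the second
the same lemma applied to the reflected steps `t b` (`≤ 0` then `≥ 0`), whose two end values are `G (m−1) = N·(mρ − 1)`
(the hypothesis) and `G 1 = θ·(U 0 + U 1) − ρ·R 0` (the row-Hall condition of the rows avoiding the member, implied by
the hypothesis through (★)).
-/

namespace PercRepro.PuncturedLYM.Split.OneArith

open Finset

section Main

variable {m n' ℓ : ℕ} {ρ θ : ℚ}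

/-- The member columns: `N = C(n', ℓ+1−m)`. -/
def N (m n' ℓ : ℕ) : ℚ := (n'.choose (ℓ + 1 - m) : ℚ)

/-- The column-Hall slack of «the member columns and the free columns above layer `a`». -/
def G (m n' ℓ : ℕ) (ρ θ : ℚ) (a : ℕ) : ℚ :=
  θ * U m n' ℓ a + ∑ b ∈ Ico a m, e m n' ℓ ρ θ b - N m n' ℓ

/-- `R (m−1) = m·N`. -/
theorem R_pred_eq (hm : 1 ≤ m) (hmℓ : m ≤ ℓ) : R m n' ℓ (m - 1) = m * N m n' ℓ := by
  unfold R N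
  have e1 : ℓ - (m - 1) = ℓ + 1 - m := by omega
  have e2 : m.choose (m - 1) = m := by
    obtain ⟨k, rfl⟩ : ∃ k, m = k + 1 := ⟨m - 1, by omega⟩
    simp [Nat.choose_succ_self_right]
  rw [e1, e2]

/-- The totals give `Hs m = N`. -/
theorem Hs_top (htot : ρ * ∑ a ∈ range m, R m n' ℓ a = N m n' ℓ + θ * ∑ a ∈ range m, U m n' ℓ a) :
    Hs m n' ℓ ρ θ m = N m n' ℓ := by
  unfold Hs e
  rw [sum_sub_distrib, ← mul_sum, ← mul_sum, htot]
  ring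

/-- `Hs a ≤ θ·U a ⟺ 0 ≤ G a` (`a ≤ m`). -/
theorem Hs_le_iff_G (htot : ρ * ∑ a ∈ range m, R m n' ℓ a = N m n' ℓ + θ * ∑ a ∈ range m, U m n' ℓ a)
    (a : ℕ) (ha : a ≤ m) : Hs m n' ℓ ρ θ a ≤ θ * U m n' ℓ a ↔ 0 ≤ G m n' ℓ ρ θ a := by
  have hsplit := sum_range_add_sum_Ico (e m n' ℓ ρ θ) ha
  have hN := Hs_top htot
  unfold Hs at hN
  unfold G Hs
  constructor <;> intro h <;> linarith

/-- `G a = G (a+1) + t a` (`a + 1 < m`). -/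
theorem G_succ (a : ℕ) (ha : a + 1 ≤ m) : G m n' ℓ ρ θ a = G m n' ℓ ρ θ (a + 1) + t m n' ℓ ρ θ a := by
  unfold G t
  have := sum_eq_sum_Ico_succ_bot (show a < m by omega) (e m n' ℓ ρ θ)
  rw [this]
  unfold e
  ring

/-- `G a = G (m−1) + Σ_{b ∈ Ico a (m−1)} t b` (`a ≤ m − 1`). -/
theorem G_eq_tail (hm : 1 ≤ m) (a : ℕ) (ha : a ≤ m - 1) :
    G m n' ℓ ρ θ a = G m n' ℓ ρ θ (m - 1) + ∑ b ∈ Ico a (m - 1), t m n' ℓ ρ θ b := by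
  obtain ⟨d, hd⟩ : ∃ d, a + d = m - 1 := ⟨m - 1 - a, by omega⟩
  induction d generalizing a with
  | zero =>
    have : a = m - 1 := by omega
    subst this; simp
  | succ d ih =>
    have h1 := G_succ (m := m) (n' := n') (ℓ := ℓ) (ρ := ρ) (θ := θ) a (by omega)
    have h2 := ih (a + 1) (by omega) (by omega)
    rw [h1, h2, sum_eq_sum_Ico_succ_bot (show a < m - 1 by omega)]
    ring

/-- `G (m−1) = N·(mρ − 1)`. -/
theorem G_pred (hm : 1 ≤ m) (hmℓ : m ≤ ℓ) : G m n' ℓ ρ θ (m - 1) = N m n' ℓ * (m * ρ - 1) := by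
  unfold G
  have : Ico (m - 1) m = {m - 1} := by
    ext b; simp only [mem_Ico, mem_singleton]; omega
  rw [this, sum_singleton]
  unfold e
  rw [R_pred_eq hm hmℓ]
  ring

/-- `G 1 = θ·(U 0 + U 1) − ρ·R 0` (from the totals). -/
theorem G_one (hm : 1 ≤ m)
    (htot : ρ * ∑ a ∈ range m, R m n' ℓ a = N m n' ℓ + θ * ∑ a ∈ range m, U m n' ℓ a) :
    G m n' ℓ ρ θ 1 = θ * (U m n' ℓ 0 + U m n' ℓ 1) - ρ * R m n' ℓ 0 := by
  have hN := Hs_top htot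
  unfold Hs at hN
  have h := sum_eq_sum_Ico_succ_bot (show 0 < m by omega) (e m n' ℓ ρ θ)
  rw [range_eq_Ico] at hN
  rw [h] at hN
  unfold G
  have he0 : e m n' ℓ ρ θ 0 = ρ * R m n' ℓ 0 - θ * U m n' ℓ 0 := rfl
  linarith


/-- Vandermonde in layers: `Σ_{a ≤ m} C(m,a)·C(n',k−a) = C(m+n',k)` (`m ≤ k`). -/
theorem vandermonde_layers (m n' k : ℕ) (hmk : m ≤ k) :
    ∑ a ∈ range (m + 1), (m.choose a : ℚ) * (n'.choose (k - a) : ℚ) = ((m + n').choose k : ℚ) := by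
  have h := Nat.add_choose_eq m n' k
  rw [Nat.sum_antidiagonal_eq_sum_range_succ_mk] at h
  have h' : ((m + n').choose k : ℚ) = ∑ a ∈ range (k + 1), (m.choose a : ℚ) * (n'.choose (k - a) : ℚ) := by
    rw [h]; push_cast; rfl
  rw [h', ← sum_range_add_sum_Ico _ (show m + 1 ≤ k + 1 by omega)]
  have hzero : ∑ a ∈ Ico (m + 1) (k + 1), (m.choose a : ℚ) * (n'.choose (k - a) : ℚ) = 0 := by
    apply sum_eq_zero
    intro a ha
    rw [mem_Ico] at ha
    rw [Nat.choose_eq_zero_of_lt (by omega)]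
    simp
  rw [hzero, add_zero]

/-- `P = Σ_{a<m} R a = C(m+n',ℓ) − C(n',ℓ−m)`. -/
theorem sum_R (hmℓ : m ≤ ℓ) :
    ∑ a ∈ range m, R m n' ℓ a = ((m + n').choose ℓ : ℚ) - (n'.choose (ℓ - m) : ℚ) := by
  have h := vandermonde_layers m n' ℓ hmℓ
  rw [sum_range_succ] at h
  unfold R
  rw [Nat.choose_self] at h
  push_cast at h
  linarith

/-- `F = Σ_{a<m} U a = C(m+n',ℓ+1) − N`. -/
theorem sum_U (hmℓ : m ≤ ℓ) :
    ∑ a ∈ range m, U m n' ℓ a = ((m + n').choose (ℓ + 1) : ℚ) - N m n' ℓ := by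
  have h := vandermonde_layers m n' (ℓ + 1) (by omega)
  rw [sum_range_succ] at h
  unfold U N
  rw [Nat.choose_self] at h
  push_cast at h
  linarith

/-- `P ≥ R (m−1) + R (m−2)` (`2 ≤ m`). -/
theorem sum_R_ge (hm : 2 ≤ m) : R m n' ℓ (m - 1) + R m n' ℓ (m - 2) ≤ ∑ a ∈ range m, R m n' ℓ a := by
  have hsub : ({m - 2, m - 1} : Finset ℕ) ⊆ range m := by
    intro a ha
    simp only [mem_insert, mem_singleton] at ha
    rw [mem_range]; omega
  have hnn : ∀ a ∈ range m, a ∉ ({m - 2, m - 1} : Finset ℕ) → 0 ≤ R m n' ℓ a := by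
    intro a _ _; unfold R; positivity
  have := sum_le_sum_of_subset_of_nonneg hsub hnn
  rw [sum_pair (by omega : m - 2 ≠ m - 1)] at this
  linarith

/-- **(★)** `R 0 · F ≤ (U 0 + U 1) · (P − m·N)` (`2 ≤ m ≤ ℓ`, `ℓ + 1 ≤ n'`). -/
theorem star (hm : 2 ≤ m) (hmℓ : m ≤ ℓ) (hn : ℓ + 1 ≤ n') :
    R m n' ℓ 0 * ∑ a ∈ range m, U m n' ℓ a
      ≤ (U m n' ℓ 0 + U m n' ℓ 1) * (∑ a ∈ range m, R m n' ℓ a - m * N m n' ℓ) := by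
  obtain ⟨p, hp⟩ : ∃ p, p = ℓ + 1 - m := ⟨_, rfl⟩
  have hp1 : 1 ≤ p := by omega
  have hR0 : R m n' ℓ 0 = (n'.choose ℓ : ℚ) := by unfold R; simp
  have hU0 : U m n' ℓ 0 = (n'.choose (ℓ + 1) : ℚ) := by unfold U; simp
  have hU1 : U m n' ℓ 1 = m * (n'.choose ℓ : ℚ) := by
    unfold U; rw [Nat.choose_one_right, Nat.add_sub_cancel]
  have hP := sum_R (n' := n') hmℓ
  have hF := sum_U (n' := n') hmℓ
  have hPge := sum_R_ge (n' := n') (ℓ := ℓ) hm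
  rw [R_pred_eq (by omega) hmℓ] at hPge
  have hR2 : R m n' ℓ (m - 2) = (m.choose 2 : ℚ) * (n'.choose (p + 1) : ℚ) := by
    unfold R
    have e1 : ℓ - (m - 2) = p + 1 := by omega
    have e2 : m.choose (m - 2) = m.choose 2 := by rw [← Nat.choose_symm (by omega : 2 ≤ m)]
    rw [e1, e2]
  have hx : (n'.choose (ℓ - m) : ℚ) = (n'.choose (p - 1) : ℚ) := by
    have : ℓ - m = p - 1 := by omega
    rw [this]
  have hNy : N m n' ℓ = (n'.choose p : ℚ) := by
    unfold N
    have : ℓ + 1 - m = p := by omega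
    rw [this]
  -- the binomial identities
  have hid0 : (n'.choose (ℓ + 1) : ℚ) * (ℓ + 1) = (n'.choose ℓ : ℚ) * (n' - ℓ) := by
    have := choose_succ_right_eq_q n' ℓ
    rwa [Nat.cast_sub (by omega)] at this
  have hI1 : (n'.choose p : ℚ) * p = (n'.choose (p - 1) : ℚ) * (n' - (p - 1)) := by
    have := choose_succ_right_eq_q n' (p - 1)
    rw [show p - 1 + 1 = p by omega, Nat.cast_sub (by omega : p - 1 ≤ n'), Nat.cast_sub hp1] at this
    push_cast at this
    linarith [this]
  have hI2 : (n'.choose (p + 1) : ℚ) * (p + 1) = (n'.choose p : ℚ) * (n' - p) := by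
    have := choose_succ_right_eq_q n' p
    rwa [Nat.cast_sub (by omega : p ≤ n')] at this
  have hI3 : ((m + n').choose (ℓ + 1) : ℚ) * (ℓ + 1) = ((m + n').choose ℓ : ℚ) * (m + n' - ℓ) := by
    have := choose_succ_right_eq_q (m + n') ℓ
    rw [Nat.cast_sub (by omega : ℓ ≤ m + n')] at this
    push_cast at this
    linarith [this]
  have c6 : (p : ℚ) = ℓ + 1 - m := by rw [hp, Nat.cast_sub (by omega)]; push_cast; ring
  have hC2 : (1 : ℚ) ≤ (m.choose 2 : ℚ) := by
    have : 1 ≤ m.choose 2 := Nat.choose_pos (by omega)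
    exact_mod_cast this
  have hkey : (p : ℚ) + 1 ≤ ℓ * (m.choose 2 : ℚ) := by
    have hmq : (2 : ℚ) ≤ m := by exact_mod_cast hm
    have h1 : (p : ℚ) + 1 ≤ ℓ := by rw [c6]; linarith
    have h2 : (ℓ : ℚ) ≤ ℓ * (m.choose 2 : ℚ) := by
      have : (0 : ℚ) ≤ ℓ := by positivity
      nlinarith
    linarith
  have hz : (0 : ℚ) ≤ (n'.choose (p + 1) : ℚ) := by positivity
  have hy : (0 : ℚ) ≤ (n'.choose p : ℚ) := by positivity
  have hn0 : (0 : ℚ) ≤ (n'.choose ℓ : ℚ) := by positivity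
  have hmq : (2 : ℚ) ≤ m := by exact_mod_cast hm
  have hℓpos : (0 : ℚ) < ℓ + 1 := by positivity
  rw [hR0, hU0, hU1, hP, hF, hx, hNy]
  rw [hR2, hNy] at hPge
  rw [hP, hx] at hPge
  -- after multiplying by `ℓ + 1`: `RHS − LHS = X·mℓ·(B − x − my − qz) + X·m·z·(qℓ − p − 1)`
  have hE : ((n'.choose (ℓ + 1) : ℚ) + m * (n'.choose ℓ : ℚ))
        * (((m + n').choose ℓ : ℚ) - (n'.choose (p - 1) : ℚ) - m * (n'.choose p : ℚ)) * (ℓ + 1)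
      - (n'.choose ℓ : ℚ) * (((m + n').choose (ℓ + 1) : ℚ) - (n'.choose p : ℚ)) * (ℓ + 1)
      = (n'.choose ℓ : ℚ) * (m * ℓ) * (((m + n').choose ℓ : ℚ) - (n'.choose (p - 1) : ℚ) - m * (n'.choose p : ℚ)
          - (m.choose 2 : ℚ) * (n'.choose (p + 1) : ℚ))
        + (n'.choose ℓ : ℚ) * m * (n'.choose (p + 1) : ℚ) * ((m.choose 2 : ℚ) * ℓ - p - 1) := by
    linear_combination (-(n'.choose ℓ : ℚ)) * hI3
      + (((m + n').choose ℓ : ℚ) - (n'.choose (p - 1) : ℚ) - m * (n'.choose p : ℚ)) * hid0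
      + (n'.choose ℓ : ℚ) * hI1 + ((n'.choose ℓ : ℚ) * m) * hI2
      - (n'.choose ℓ : ℚ) * ((n'.choose (p - 1) : ℚ) + m * (n'.choose p : ℚ) + (n'.choose p : ℚ)) * c6
  have hA : 0 ≤ (n'.choose ℓ : ℚ) * (m * ℓ) * (((m + n').choose ℓ : ℚ) - (n'.choose (p - 1) : ℚ) - m * (n'.choose p : ℚ)
      - (m.choose 2 : ℚ) * (n'.choose (p + 1) : ℚ)) := by
    apply mul_nonneg (mul_nonneg hn0 (by positivity))
    linarith [hPge]
  have hB : 0 ≤ (n'.choose ℓ : ℚ) * m * (n'.choose (p + 1) : ℚ) * ((m.choose 2 : ℚ) * ℓ - p - 1) := by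
    apply mul_nonneg (mul_nonneg (mul_nonneg hn0 (by positivity)) hz)
    linarith [hkey]
  have hmain : (n'.choose ℓ : ℚ) * (((m + n').choose (ℓ + 1) : ℚ) - (n'.choose p : ℚ)) * (ℓ + 1)
      ≤ ((n'.choose (ℓ + 1) : ℚ) + m * (n'.choose ℓ : ℚ))
        * (((m + n').choose ℓ : ℚ) - (n'.choose (p - 1) : ℚ) - m * (n'.choose p : ℚ)) * (ℓ + 1) := by
    linarith [hE, hA, hB]
  exact le_of_mul_le_mul_right hmain hℓpos


/-- `G 1 ≥ 0` from `mρ ≥ 1`, the totals and (★). -/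
theorem G_one_nonneg (hm : 2 ≤ m) (hmℓ : m ≤ ℓ) (hn : ℓ + 1 ≤ n') (hC : 1 ≤ m * ρ)
    (htot : ρ * ∑ a ∈ range m, R m n' ℓ a = N m n' ℓ + θ * ∑ a ∈ range m, U m n' ℓ a) :
    0 ≤ G m n' ℓ ρ θ 1 := by
  rw [G_one (by omega) htot]
  have hstar := star (n' := n') (ℓ := ℓ) hm hmℓ hn
  set P := ∑ a ∈ range m, R m n' ℓ a with hP_def
  set F := ∑ a ∈ range m, U m n' ℓ a with hF_def
  set V := U m n' ℓ 0 + U m n' ℓ 1 with hV_def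
  set R0 := R m n' ℓ 0 with hR0_def
  set Nq := N m n' ℓ with hN_def
  have hN0 : 0 ≤ Nq := by rw [hN_def]; unfold N; positivity
  have hR00 : 0 ≤ R0 := by rw [hR0_def]; unfold R; positivity
  have hV0 : 0 ≤ V := by rw [hV_def]; unfold U; positivity
  have hmq : (2 : ℚ) ≤ m := by exact_mod_cast hm
  have hFpos : 0 < F := by
    have h0 : 0 < U m n' ℓ 0 := by
      unfold U; simp only [Nat.choose_zero_right, Nat.cast_one, one_mul, Nat.sub_zero]
      exact_mod_cast Nat.choose_pos (by omega)
    have : U m n' ℓ 0 ≤ F := by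
      rw [hF_def]
      exact single_le_sum (fun a _ => by unfold U; positivity) (mem_range.2 (by omega))
    linarith
  have hPpos : 0 < P := by
    have h0 : 0 < R m n' ℓ 0 := by
      unfold R; simp only [Nat.choose_zero_right, Nat.cast_one, one_mul, Nat.sub_zero]
      exact_mod_cast Nat.choose_pos (by omega)
    have : R m n' ℓ 0 ≤ P := by
      rw [hP_def]
      exact single_le_sum (fun a _ => by unfold R; positivity) (mem_range.2 (by omega))
    linarith
  -- `θ·m·F ≥ P − m·N`
  have h1 : P - m * Nq ≤ θ * m * F := by
    have : P ≤ m * ρ * P := by nlinarith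
    nlinarith [htot]
  -- `K' = V·P − F·R0 ≥ V·m·N ≥ 0`
  have hK : V * m * Nq ≤ V * P - F * R0 := by nlinarith [hstar]
  have hK0 : 0 ≤ V * P - F * R0 := by nlinarith [hK, mul_nonneg (mul_nonneg hV0 (by positivity : (0:ℚ) ≤ m)) hN0]
  -- `(P − mN)·K' ≥ F·R0·m·N`
  have h2 : F * R0 * (m * Nq) ≤ (P - m * Nq) * (V * P - F * R0) := by
    have hx : F * R0 * P ≤ (P - m * Nq) * V * P := by
      have := mul_le_mul_of_nonneg_right hstar hPpos.le
      linarith [this]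
    nlinarith [hx]
  -- hence `θ·K' ≥ N·R0`
  have h3 : Nq * R0 ≤ θ * (V * P - F * R0) := by
    have hmF : 0 < m * F := by positivity
    have : (θ * m * F) * (V * P - F * R0) ≥ (P - m * Nq) * (V * P - F * R0) :=
      mul_le_mul_of_nonneg_right h1 hK0
    have h4 : (m * F) * (Nq * R0) ≤ (m * F) * (θ * (V * P - F * R0)) := by nlinarith [this, h2]
    exact le_of_mul_le_mul_left h4 hmF
  -- and `θ·V·P ≥ ρ·R0·P`
  have h5 : ρ * R0 * P ≤ θ * V * P := by
    have : ρ * P * R0 = Nq * R0 + θ * F * R0 := by rw [htot]; ring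
    nlinarith [h3, this]
  have h6 : ρ * R0 ≤ θ * V := le_of_mul_le_mul_right h5 hPpos
  linarith

/-- **THE LAYER INEQUALITIES.** For `2 ≤ m ≤ ℓ`, `ℓ + 1 ≤ n'`, `θ ≥ 0`, `m·ρ ≥ 1` and the totals: every partial sum
`Hs a` (`a ≤ m`) is nonnegative and `Hs a ≤ θ·U a` for `1 ≤ a < m`. -/
theorem layer_ineq (hm : 2 ≤ m) (hmℓ : m ≤ ℓ) (hn : ℓ + 1 ≤ n') (hθ : 0 ≤ θ) (hC : 1 ≤ m * ρ)
    (htot : ρ * ∑ a ∈ range m, R m n' ℓ a = N m n' ℓ + θ * ∑ a ∈ range m, U m n' ℓ a) :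
    (∀ a, a ≤ m → 0 ≤ Hs m n' ℓ ρ θ a) ∧ (∀ a, 1 ≤ a → a < m → Hs m n' ℓ ρ θ a ≤ θ * U m n' ℓ a) := by
  have hρ : 0 ≤ ρ := by
    have hmq : (0 : ℚ) < m := by exact_mod_cast (by omega : 0 < m)
    by_contra h
    push Not at h
    have := mul_neg_of_pos_of_neg hmq h
    linarith
  have hN0 : 0 ≤ N m n' ℓ := by unfold N; positivity
  constructor
  · intro a ha
    have := sum_range_ge_min_zero (e m n' ℓ ρ θ) m
      (fun b b' hbb' hb' h => e_nonneg_mono hmℓ hn hθ b b' hbb' hb' h) a ha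
    have hN := Hs_top htot
    unfold Hs at hN ⊢
    rw [hN] at this
    have : min (0 : ℚ) (N m n' ℓ) = 0 := min_eq_left hN0
    linarith [this]
  · intro a ha1 ham
    rw [Hs_le_iff_G htot a ham.le]
    rw [G_eq_tail (by omega) a (by omega)]
    -- the tail sum, reflected: `Σ_{b ∈ Ico a (m−1)} t b = Σ_{c < m−1−a} t (m−2−c)`
    have hrefl : ∀ a', a' ≤ m - 1 → ∑ b ∈ Ico a' (m - 1), t m n' ℓ ρ θ b
        = ∑ c ∈ range (m - 1 - a'), t m n' ℓ ρ θ (m - 2 - c) := by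
      intro a' ha'
      rw [sum_Ico_eq_sum_range, ← sum_range_reflect]
      apply sum_congr rfl
      intro c hc
      rw [mem_range] at hc
      congr 1
      omega
    rw [hrefl a (by omega)]
    have hmono : ∀ c c', c ≤ c' → c' < m - 2 → 0 ≤ t m n' ℓ ρ θ (m - 2 - c') → 0 ≤ t m n' ℓ ρ θ (m - 2 - c) := by
      intro c c' hcc' hc' h
      exact t_nonneg_mono hmℓ hn hρ hθ (m - 2 - c') (m - 2 - c) (by omega) (by omega) h
    have hmin := sum_range_ge_min_zero (fun c => t m n' ℓ ρ θ (m - 2 - c)) (m - 2) hmono (m - 1 - a) (by omega)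
    have hG1 : G m n' ℓ ρ θ 1 = G m n' ℓ ρ θ (m - 1) + ∑ c ∈ range (m - 2), t m n' ℓ ρ θ (m - 2 - c) := by
      rw [G_eq_tail (by omega) 1 (by omega), hrefl 1 (by omega)]
      rw [show m - 1 - 1 = m - 2 by omega]
    have hGpred : 0 ≤ G m n' ℓ ρ θ (m - 1) := by
      rw [G_pred (by omega) hmℓ]
      apply mul_nonneg hN0
      linarith
    have hGone := G_one_nonneg hm hmℓ hn hC htot
    rcases le_or_gt (0 : ℚ) (∑ c ∈ range (m - 2), t m n' ℓ ρ θ (m - 2 - c)) with hs | hs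
    · rw [min_eq_left hs] at hmin
      linarith
    · rw [min_eq_right hs.le] at hmin
      linarith

end Main

end PercRepro.PuncturedLYM.Split.OneArith
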